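import Mathlib.MeasureTheory.Integral.IntervalIntegral.Periodic
import Mathlib.Analysis.Normed.Group.AddCircle
import Mathlib.Analysis.SpecialFunctions.Log.Basic
import Literature.NumberTheory.ConnesConsani2023.RiemannRochSpecZ
import HarnessLib

/-!
# Connes–Consani, Riemann–Roch for `Spec ℤ̄` — proof of Proposition 4.1 (the dimension of `U(1)_λ`)

Discharges the named fact `Literature.NumberTheory.ConnesConsani2023.dim_U1_eq`
(A. Connes, C. Consani, *Riemann–Roch for `\overline{Spec ℤ}`*, Bull. Sci. Math. 187 (2023) 103293,
Prop. 4.1, arXiv p. 10 [bib: `ConnesConsani2023RiemannRoch`]):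
for `λ > 0`, `dim_{𝕊[±1]} U(1)_λ = ⌈(−log λ − log 2)/log 3⌉` if `λ < 1/2` and `= 0` if `λ ≥ 1/2`, where
`U(1)_λ = (ℝ/ℤ, d)_λ` and the dimension is the least cardinality of a `λ`-separated `F ⊂ ℝ/ℤ` whose
signed sums `Σ_F α_j j`, `α_j ∈ {-1,0,1}`, are `λ`-dense (`PmTolGenerates` / `pmTolDim`).

We FOLLOW THE PRINTED PROOF (p. 10): (a) `λ ≥ 1/2`: `F = ∅` generates since every point is within
`1/2` of `0`; (b) lower bound: the `3^{#F}` closed balls of radius `λ` around the signed sums cover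
`ℝ/ℤ`, so `2λ · 3^{#F} ≥ 1` (Haar measure, `AddCircle.volume_closedBall`), i.e.
`#F ≥ (−log λ − log 2)/log 3`; (c) upper bound: with `m = ⌈(−log λ − log 2)/log 3⌉`,
`F(m) = {3^{-1}, …, 3^{-m}}` is `λ`-separated (distinct elements differ by `≥ 2·3^{-m} > λ`) and
generating: by balanced ternary expansion (Lemma 3.1; here with a carry, `q = Σ_{i<m} α_i 3^i + c 3^m`
for EVERY integer `q`, which avoids choosing a fundamental domain) every `y ∈ ℝ` is within
`3^{-m}/2 ≤ λ` of `Σ α_i 3^{i-m}` modulo `ℤ`.  Deviation from print: none in substance; the carry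
form of Lemma 3.1 replaces "let `x ∈ [-1/2, 1/2]`".
-/

noncomputable section

open MeasureTheory Set Finset

namespace Literature.NumberTheory.ConnesConsani2023

/-! ## Generalities on `pmTolDim` -/

section General

variable {A : Type*} [SeminormedAddCommGroup A]

/-- A generating set bounds the dimension from above. [folklore] -/
theorem pmTolDim_le_card {lam : ℝ} {F : Finset A} (h : PmTolGenerates lam F) :
    pmTolDim A lam ≤ F.card :=
  Nat.sInf_le ⟨F, rfl, h⟩

/-- If some generating set exists and every generating set has at least `k` elements, the dimension
is at least `k`. [folklore] -/
theorem le_pmTolDim {lam : ℝ} {k : ℕ} (hne : ∃ F : Finset A, PmTolGenerates lam F)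
    (h : ∀ F : Finset A, PmTolGenerates lam F → k ≤ F.card) : k ≤ pmTolDim A lam := by
  obtain ⟨F, hF⟩ := hne
  have hmem : pmTolDim A lam ∈ {k : ℕ | ∃ F : Finset A, F.card = k ∧ PmTolGenerates lam F} :=
    Nat.sInf_mem ⟨F.card, F, rfl, hF⟩
  obtain ⟨F₀, hF₀, hgen⟩ := hmem
  rw [← hF₀]
  exact h F₀ hgen

end General

/-! ## Balanced ternary with carry (Lemma 3.1 of the paper, in the form needed) -/

/-- Every integer `q` is `Σ_{i<m} d_i 3^i + c · 3^m` with digits `d_i ∈ {-1, 0, 1}` (balanced ternary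
expansion, CC 2023 Lemma 3.1 / Remark 3.2, with the overflow collected in the carry `c`).
[cite: ConnesConsani2023RiemannRoch, Lemma 3.1 p. 7] -/
theorem exists_balancedTernary (m : ℕ) (q : ℤ) :
    ∃ d : ℕ → ℤ, (∀ i, d i = -1 ∨ d i = 0 ∨ d i = 1) ∧
      ∃ c : ℤ, q = (∑ i ∈ Finset.range m, d i * 3 ^ i) + c * 3 ^ m := by
  induction m generalizing q with
  | zero => exact ⟨fun _ => 0, fun _ => Or.inr (Or.inl rfl), q, by simp⟩
  | succ m ih =>
    -- `q + 1 = 3 q' + s` with `0 ≤ s < 3`; digit `s - 1 ∈ {-1,0,1}`, `q = 3 q' + (s - 1)`.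
    set q' : ℤ := (q + 1) / 3 with hq'
    set s : ℤ := (q + 1) % 3 with hs
    have hdiv : 3 * q' + s = q + 1 := by omega
    have hs0 : 0 ≤ s := by omega
    have hs3 : s < 3 := by omega
    obtain ⟨d', hd', c, hc⟩ := ih q'
    let d : ℕ → ℤ := fun i => if i = 0 then s - 1 else d' (i - 1)
    have hd0 : d 0 = s - 1 := by simp [d]
    have hdS : ∀ i, d (i + 1) = d' i := fun i => by simp [d]
    refine ⟨d, ?_, c, ?_⟩
    · intro i
      cases i with
      | zero => rw [hd0]; omega
      | succ i => rw [hdS]; exact hd' i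
    · rw [Finset.sum_range_succ']
      simp only [hdS, hd0, pow_zero, mul_one]
      have hS : ∑ i ∈ Finset.range m, d' i * (3 : ℤ) ^ (i + 1)
          = 3 * ∑ i ∈ Finset.range m, d' i * 3 ^ i := by
        rw [Finset.mul_sum]
        exact Finset.sum_congr rfl fun i _ => by ring
      have hq : q = 3 * q' + (s - 1) := by linarith
      linear_combination hq + 3 * hc - hS

/-! ## The circle `U(1) = ℝ/ℤ` -/

/-- Every point of `ℝ/ℤ` is within `1/2` of `0`. [folklore] -/
theorem norm_le_half (x : AddCircle (1 : ℝ)) : ‖x‖ ≤ 1 / 2 := by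
  have := AddCircle.norm_le_half_period (1 : ℝ) (x := x) one_ne_zero
  simpa using this

/-- Prop. 4.1, case `λ ≥ 1/2`: the empty set generates, so the dimension is `0`.
[cite: ConnesConsani2023RiemannRoch, Prop. 4.1 p. 10] -/
theorem pmTolGenerates_empty {lam : ℝ} (h : 1 / 2 ≤ lam) :
    PmTolGenerates (A := AddCircle (1 : ℝ)) lam ∅ := by
  refine ⟨by simp, fun x => ⟨fun _ => 0, by simp, ?_⟩⟩
  rw [Finset.sum_empty, dist_zero_right]
  exact (norm_le_half x).trans h

/-- Prop. 4.1, case `λ ≥ 1/2`. [cite: ConnesConsani2023RiemannRoch, Prop. 4.1 p. 10] -/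
theorem pmTolDim_eq_zero {lam : ℝ} (h : 1 / 2 ≤ lam) : pmTolDim (AddCircle (1 : ℝ)) lam = 0 :=
  Nat.le_zero.mp (by simpa using pmTolDim_le_card (pmTolGenerates_empty h))

/-! ## Lower bound: the covering / measure argument -/

/-- The `3^{#F}` signed sums of a generating set are `λ`-dense, hence `1 ≤ 3^{#F} · 2λ` when `2λ ≤ 1`
(Haar measure of `ℝ/ℤ` is `1`, a closed ball of radius `λ` has measure `2λ`).
[cite: ConnesConsani2023RiemannRoch, Prop. 4.1 p. 10] -/
theorem one_le_pow_card_mul {lam : ℝ} (hlam : 0 ≤ lam) (h2 : 2 * lam ≤ 1)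
    {F : Finset (AddCircle (1 : ℝ))} (hF : PmTolGenerates lam F) :
    (1 : ℝ) ≤ 3 ^ F.card * (2 * lam) := by
  classical
  -- the finite set of signed sums
  let D : Finset ℤ := {-1, 0, 1}
  let Φ : (↥F → ℤ) → AddCircle (1 : ℝ) := fun β => ∑ j ∈ F.attach, β j • (j : AddCircle (1 : ℝ))
  let T : Finset (AddCircle (1 : ℝ)) := (Fintype.piFinset fun _ : ↥F => D).image Φ
  have hTcard : (T.card : ℝ) ≤ 3 ^ F.card := by
    have h1 : T.card ≤ (Fintype.piFinset fun _ : ↥F => D).card := Finset.card_image_le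
    rw [Fintype.card_piFinset, Finset.prod_const, Finset.card_univ, Fintype.card_coe] at h1
    have hD : D.card = 3 := by decide
    rw [hD] at h1
    exact_mod_cast h1
  -- covering
  have hcover : (univ : Set (AddCircle (1 : ℝ))) ⊆ ⋃ t ∈ T, Metric.closedBall t lam := by
    intro x _
    obtain ⟨α, hα, hdist⟩ := hF.2 x
    have hβ : (fun j : ↥F => α j) ∈ Fintype.piFinset fun _ : ↥F => D := by
      rw [Fintype.mem_piFinset]
      intro j
      rcases hα j j.2 with h | h | h <;> simp [D, h]
    have hΦ : Φ (fun j : ↥F => α j) = ∑ j ∈ F, α j • j := by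
      simp only [Φ]
      exact Finset.sum_attach F fun j => α j • j
    refine Set.mem_iUnion₂.mpr ⟨Φ fun j : ↥F => α j, Finset.mem_image.mpr ⟨_, hβ, rfl⟩, ?_⟩
    rw [Metric.mem_closedBall, hΦ]
    exact hdist
  -- measure
  have hmeas : (1 : ENNReal) ≤ (T.card : ENNReal) * ENNReal.ofReal (2 * lam) := by
    calc (1 : ENNReal) = volume (univ : Set (AddCircle (1 : ℝ))) := by
            rw [AddCircle.measure_univ]; simp
      _ ≤ volume (⋃ t ∈ T, Metric.closedBall t lam) := measure_mono hcover
      _ ≤ ∑ t ∈ T, volume (Metric.closedBall t lam) := measure_biUnion_finset_le T _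
      _ = ∑ t ∈ T, ENNReal.ofReal (2 * lam) := by
            refine Finset.sum_congr rfl fun t _ => ?_
            rw [AddCircle.volume_closedBall, min_eq_right h2]
      _ = (T.card : ENNReal) * ENNReal.ofReal (2 * lam) := by
            rw [Finset.sum_const, nsmul_eq_mul]
  have hmeas' : ENNReal.ofReal 1 ≤ ENNReal.ofReal (T.card * (2 * lam)) := by
    rw [ENNReal.ofReal_one, ENNReal.ofReal_mul (Nat.cast_nonneg _), ENNReal.ofReal_natCast]
    exact hmeas
  rw [ENNReal.ofReal_le_ofReal_iff (by positivity)] at hmeas'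
  calc (1 : ℝ) ≤ T.card * (2 * lam) := hmeas'
    _ ≤ 3 ^ F.card * (2 * lam) := by gcongr

/-- Lower bound of Prop. 4.1: a generating set for `λ < 1/2` has at least
`(−log λ − log 2)/log 3` elements. [cite: ConnesConsani2023RiemannRoch, Prop. 4.1 p. 10] -/
theorem logBound_le_card {lam : ℝ} (hlam : 0 < lam) (hlam2 : lam < 1 / 2)
    {F : Finset (AddCircle (1 : ℝ))} (hF : PmTolGenerates lam F) :
    (-Real.log lam - Real.log 2) / Real.log 3 ≤ F.card := by
  have h := one_le_pow_card_mul hlam.le (by linarith) hF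
  have hlog3 : 0 < Real.log 3 := Real.log_pos (by norm_num)
  rw [div_le_iff₀ hlog3]
  -- take logarithms of `1 ≤ 3^k · (2λ)`
  have hpos : 0 < (3 : ℝ) ^ F.card * (2 * lam) := by positivity
  have hl := Real.log_le_log one_pos h
  rw [Real.log_one, Real.log_mul (by positivity) (by positivity), Real.log_pow,
    Real.log_mul (by norm_num) hlam.ne'] at hl
  linarith

/-- The covering map `ℝ → ℝ/ℤ` is additive on finite sums. [folklore] -/
private theorem coe_finset_sum {ι : Type*} (s : Finset ι) (f : ι → ℝ) :
    (((∑ i ∈ s, f i : ℝ)) : AddCircle (1 : ℝ)) = ∑ i ∈ s, ((f i : ℝ) : AddCircle (1 : ℝ)) :=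
  map_sum (QuotientAddGroup.mk' (AddSubgroup.zmultiples (1 : ℝ))) f s

/-! ## Upper bound: the set `F(m) = {3^{-1}, …, 3^{-m}}` -/

section Upper

variable (m : ℕ)

/-- `r i = 3^i / 3^m = 3^{i - m}`, `i < m`: the elements `3^{-1}, …, 3^{-m}` of `F(m)` as reals
(CC 2023 proof of Prop. 4.1). [cite: ConnesConsani2023RiemannRoch, Prop. 4.1 p. 10] -/
private def r (i : Fin m) : ℝ := (3 : ℝ) ^ (i : ℕ) / 3 ^ m

/-- `r i > 0`. [folklore] -/
private theorem r_pos (i : Fin m) : 0 < r m i := by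
  unfold r; positivity

/-- `r i ≤ 1/3` since `i ≤ m - 1`. [folklore] -/
private theorem r_le_third (i : Fin m) : r m i ≤ 1 / 3 := by
  unfold r
  rw [div_le_div_iff₀ (by positivity) (by norm_num), one_mul]
  have : (3 : ℝ) ^ ((i : ℕ) + 1) ≤ 3 ^ m :=
    pow_le_pow_right₀ (by norm_num) (Nat.succ_le_of_lt i.2)
  simpa [pow_succ] using this

/-- `r i ∈ [0, 1)`, a fundamental domain of `ℝ/ℤ`. [folklore] -/
private theorem r_mem_Ico (i : Fin m) : r m i ∈ Ico (0 : ℝ) (0 + 1) :=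
  ⟨(r_pos m i).le, by linarith [r_le_third m i]⟩

/-- Distinct elements of `F(m)` differ, as reals, by at least `2 · 3^{-m}` ("the minimal distance between
two elements of `F(m)` is … `2 · 3^{-m}`", proof of Prop. 4.1). [cite: ConnesConsani2023RiemannRoch, Prop. 4.1 p. 10] -/
private theorem two_div_le_abs_sub {i j : Fin m} (h : i ≠ j) :
    2 / (3 : ℝ) ^ m ≤ |r m i - r m j| := by
  have key : ∀ {a b : ℕ}, a < b → (2 : ℝ) ≤ 3 ^ b - 3 ^ a := by
    intro a b hab
    have h1 : (3 : ℝ) ^ (a + 1) ≤ 3 ^ b := pow_le_pow_right₀ (by norm_num) hab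
    have h2 : (1 : ℝ) ≤ 3 ^ a := one_le_pow₀ (by norm_num)
    rw [pow_succ] at h1
    linarith
  have hne : (i : ℕ) ≠ (j : ℕ) := fun e => h (Fin.ext e)
  unfold r
  rw [← sub_div, abs_div, abs_of_pos (by positivity : (0 : ℝ) < 3 ^ m),
    div_le_div_iff_of_pos_right (by positivity)]
  rcases lt_or_gt_of_ne hne with hlt | hgt
  · rw [abs_sub_comm]
    exact (key hlt).trans (le_abs_self _)
  · exact (key hgt).trans (le_abs_self _)

/-- The points `3^{-1}, …, 3^{-m}` of `ℝ/ℤ` (the set `F(m)` of the proof of Prop. 4.1, indexed by `Fin m`).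
[cite: ConnesConsani2023RiemannRoch, Prop. 4.1 p. 10] -/
private def e (i : Fin m) : AddCircle (1 : ℝ) := ((r m i : ℝ) : AddCircle (1 : ℝ))

/-- The points `3^{-j}`, `1 ≤ j ≤ m`, are distinct in `ℝ/ℤ`. [folklore] -/
private theorem e_injective : Function.Injective (e m) := by
  intro i j hij
  have := (AddCircle.coe_eq_coe_iff_of_mem_Ico (r_mem_Ico m i) (r_mem_Ico m j)).mp hij
  -- `3^i / 3^m = 3^j / 3^m`
  unfold r at this
  have h3 : (3 : ℝ) ^ (i : ℕ) = 3 ^ (j : ℕ) := by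
    have hm : (0 : ℝ) < 3 ^ m := by positivity
    field_simp at this
    linarith [this]
  exact Fin.ext (pow_right_injective₀ (by norm_num) (by norm_num) h3)

/-- The distance in `ℝ/ℤ` between distinct points of `F(m)` is at least `2 · 3^{-m}`.
[cite: ConnesConsani2023RiemannRoch, Prop. 4.1 p. 10] -/
private theorem two_div_le_dist {i j : Fin m} (h : i ≠ j) :
    2 / (3 : ℝ) ^ m ≤ dist (e m i) (e m j) := by
  have habs : |r m i - r m j| ≤ |(1 : ℝ)| / 2 := by
    rw [abs_one, abs_le]
    constructor <;> linarith [r_pos m i, r_pos m j, r_le_third m i, r_le_third m j]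
  rw [dist_eq_norm, e, e, ← AddCircle.coe_sub,
    (AddCircle.norm_coe_eq_abs_iff (1 : ℝ) one_ne_zero).mpr habs]
  exact two_div_le_abs_sub m h

/-- The set `F(m) = {3^{-1}, …, 3^{-m}} ⊂ ℝ/ℤ` of the proof of Prop. 4.1.
[cite: ConnesConsani2023RiemannRoch, Prop. 4.1 p. 10] -/
private def Fm : Finset (AddCircle (1 : ℝ)) := Finset.univ.image (e m)

/-- `#F(m) = m`. [folklore] -/
private theorem card_Fm : (Fm m).card = m := by
  rw [Fm, Finset.card_image_of_injective _ (e_injective m), Finset.card_univ, Fintype.card_fin]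

/-- `F(m)` generates `U(1)_λ` as soon as `3^{-m}/2 ≤ λ < 2 · 3^{-m}` (separation from the second
inequality, density from balanced ternary and the first).
[cite: ConnesConsani2023RiemannRoch, Prop. 4.1 p. 10] -/
theorem pmTolGenerates_Fm {lam : ℝ} (hlo : 1 / (2 * (3 : ℝ) ^ m) ≤ lam)
    (hhi : lam < 2 / (3 : ℝ) ^ m) : PmTolGenerates lam (Fm m) := by
  classical
  refine ⟨?_, ?_⟩
  · -- separation
    intro x hx y hy hxy
    obtain ⟨i, -, rfl⟩ := Finset.mem_image.mp hx
    obtain ⟨j, -, rfl⟩ := Finset.mem_image.mp hy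
    have hij : i ≠ j := fun h => hxy (by rw [h])
    exact hhi.trans_le (two_div_le_dist m hij)
  · -- density
    intro x
    obtain ⟨y, rfl⟩ := QuotientAddGroup.mk_surjective x
    have h3m : (0 : ℝ) < 3 ^ m := by positivity
    set q : ℤ := round ((3 : ℝ) ^ m * y) with hq
    obtain ⟨d, hd, c, hc⟩ := exists_balancedTernary m q
    -- coefficients: `d i` on the point `e i`, `0` elsewhere
    let α : AddCircle (1 : ℝ) → ℤ := Function.extend (e m) (fun i => d i) 0
    have hαe : ∀ i, α (e m i) = d i := fun i => (e_injective m).extend_apply _ _ i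
    refine ⟨α, ?_, ?_⟩
    · intro j hj
      obtain ⟨i, -, rfl⟩ := Finset.mem_image.mp hj
      rw [hαe]
      exact hd i
    · -- the signed sum is the class of `s = Σ d_i 3^i / 3^m`
      set s : ℝ := ∑ i : Fin m, (d i : ℝ) * r m i with hs
      have hsum : ∑ j ∈ Fm m, α j • j = ((s : ℝ) : AddCircle (1 : ℝ)) := by
        rw [Fm, Finset.sum_image fun i _ j _ h => e_injective m h, hs, coe_finset_sum]
        refine Finset.sum_congr rfl fun i _ => ?_
        rw [hαe, e, ← AddCircle.coe_zsmul, zsmul_eq_mul]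
      rw [hsum]
      -- `q = Σ d_i 3^i + c 3^m` gives `y - s - c = (3^m y - q) / 3^m`
      have hqs : (q : ℝ) / 3 ^ m = s + c := by
        have : (q : ℝ) = (∑ i ∈ Finset.range m, (d i : ℝ) * 3 ^ i) + c * 3 ^ m := by
          rw [hc]; push_cast; rfl
        rw [this, add_div, mul_div_cancel_right₀ _ h3m.ne', hs, Finset.sum_div]
        congr 1
        rw [Finset.sum_range (fun i => (d i : ℝ) * 3 ^ i / 3 ^ m)]
        refine Finset.sum_congr rfl fun i _ => ?_
        unfold r; ring
      have hdist : dist ((y : ℝ) : AddCircle (1 : ℝ)) ((s : ℝ) : AddCircle (1 : ℝ))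
          = ‖(((y - s - c : ℝ)) : AddCircle (1 : ℝ))‖ := by
        rw [dist_eq_norm, ← AddCircle.coe_sub]
        congr 1
        rw [sub_sub, AddCircle.coe_sub, AddCircle.coe_sub, AddCircle.coe_add]
        have hc0 : ((c : ℝ) : AddCircle (1 : ℝ)) = 0 := by
          rw [AddCircle.coe_eq_zero_iff]
          exact ⟨c, by simp⟩
        rw [hc0, add_zero]
      rw [hdist]
      calc ‖(((y - s - c : ℝ)) : AddCircle (1 : ℝ))‖ ≤ ‖y - s - c‖ :=
              QuotientAddGroup.norm_mk_le_norm
        _ = |(3 : ℝ) ^ m * y - q| / 3 ^ m := by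
              rw [Real.norm_eq_abs]
              have : y - s - c = ((3 : ℝ) ^ m * y - q) / 3 ^ m := by
                field_simp
                have := hqs
                field_simp at this
                linarith
              rw [this, abs_div, abs_of_pos h3m]
        _ ≤ (1 / 2) / 3 ^ m := by
              gcongr
              exact abs_sub_round _
        _ = 1 / (2 * 3 ^ m) := by ring
        _ ≤ lam := hlo

end Upper

/-! ## Assembly -/

/-- **Prop. 4.1 of Connes–Consani 2023, PROVED** (discharges the named fact `dim_U1_eq`).
[cite: ConnesConsani2023RiemannRoch, Prop. 4.1 p. 10] -/
theorem dim_U1_eq_holds : dim_U1_eq := by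
  intro lam hlam
  refine ⟨fun hlam2 => ?_, fun h => pmTolDim_eq_zero h⟩
  have hlog3 : 0 < Real.log 3 := Real.log_pos (by norm_num)
  set L : ℝ := (-Real.log lam - Real.log 2) / Real.log 3 with hL
  -- `L = log_3 (1/(2λ)) > 0`
  have h2lam : 0 < 2 * lam := by positivity
  have hLnum : -Real.log lam - Real.log 2 = -Real.log (2 * lam) := by
    rw [Real.log_mul (by norm_num) hlam.ne']; ring
  have hLpos : 0 < L := by
    rw [hL, hLnum]
    exact div_pos (neg_pos.mpr (Real.log_neg h2lam (by linarith))) hlog3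
  -- `m = ⌈L⌉` as a natural number
  set m : ℕ := (⌈L⌉).toNat with hm
  have hceil_nonneg : 0 ≤ ⌈L⌉ := Int.ceil_nonneg hLpos.le
  have hmZ : (m : ℤ) = ⌈L⌉ := by rw [hm, Int.toNat_of_nonneg hceil_nonneg]
  have hmR : (m : ℝ) = (⌈L⌉ : ℝ) := by exact_mod_cast hmZ
  have hLm : L ≤ m := by rw [hmR]; exact Int.le_ceil L
  have hmL : (m : ℝ) < L + 1 := by rw [hmR]; exact Int.ceil_lt_add_one L
  -- the two power inequalities: `3^L = 1/(2λ)`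
  have h3L : (3 : ℝ) ^ L = 1 / (2 * lam) := by
    rw [hL, hLnum, Real.rpow_def_of_pos (by norm_num : (0 : ℝ) < 3)]
    rw [show Real.log 3 * (-Real.log (2 * lam) / Real.log 3) = -Real.log (2 * lam) by
      field_simp]
    rw [Real.exp_neg, Real.exp_log h2lam, one_div]
  have hpow_m : (3 : ℝ) ^ (m : ℝ) = (3 : ℝ) ^ m := Real.rpow_natCast 3 m
  have hlo : 1 / (2 * (3 : ℝ) ^ m) ≤ lam := by
    -- from `L ≤ m`: `3^L ≤ 3^m`
    have : (3 : ℝ) ^ L ≤ (3 : ℝ) ^ (m : ℝ) :=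
      Real.rpow_le_rpow_of_exponent_le (by norm_num) hLm
    rw [h3L, hpow_m] at this
    have h3m : (0 : ℝ) < 3 ^ m := by positivity
    rw [div_le_iff₀ (by positivity)]
    rw [div_le_iff₀ h2lam] at this
    linarith
  have hhi : lam < 2 / (3 : ℝ) ^ m := by
    -- from `m < L + 1`: `3^m < 3^{L+1} = 3/(2λ)`
    have : (3 : ℝ) ^ (m : ℝ) < (3 : ℝ) ^ (L + 1) :=
      Real.rpow_lt_rpow_of_exponent_lt (by norm_num) hmL
    rw [hpow_m, Real.rpow_add (by norm_num), h3L, Real.rpow_one] at this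
    have h3m : (0 : ℝ) < 3 ^ m := by positivity
    rw [lt_div_iff₀ h3m]
    have : (3 : ℝ) ^ m * (2 * lam) < 3 := by
      rw [div_mul_eq_mul_div, one_mul, lt_div_iff₀ h2lam] at this
      linarith
    linarith
  -- conclude: `pmTolDim = m`
  have hgen : PmTolGenerates lam (Fm m) := pmTolGenerates_Fm m hlo hhi
  have hle : pmTolDim (AddCircle (1 : ℝ)) lam ≤ m := by
    simpa [card_Fm] using pmTolDim_le_card hgen
  have hge : m ≤ pmTolDim (AddCircle (1 : ℝ)) lam := by
    refine le_pmTolDim ⟨Fm m, hgen⟩ fun F hF => ?_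
    have h1 : L ≤ F.card := logBound_le_card hlam hlam2 hF
    have h2 : ⌈L⌉ ≤ (F.card : ℤ) := Int.ceil_le.mpr (by exact_mod_cast h1)
    omega
  have : pmTolDim (AddCircle (1 : ℝ)) lam = m := le_antisymm hle hge
  rw [this, hmZ]

end Literature.NumberTheory.ConnesConsani2023

end
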